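import Mathlib.Analysis.Convex.Function
import Mathlib.Data.Real.Basic
import Mathlib.Tactic.Linarith
import Mathlib.Tactic.NormNum
import HarnessLib

/-!
# The recorded laws of the sixth-edge ladder do not decide the two pieces of the reshaped line
# (independence profiles), and they DO kill the «half-edge» stub `growHalf`

Support note for `stmt-MatrixMultiplication-26697` (`TetraExcessZero`) of route `TetrahedronCarving`
(lineage `decomp-mm-lens-6`, generation 24), companion of `EdgePencilSixthConvexity`.

The tree records, for `ω`, `ψ = ω(2,1,2) = χ(0)`, `T = ω(K₄) = χ(1)` and the ladder `χ = omegaSix`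
on `[0,1]`, exactly: `2 ≤ ω`, `4 ≤ ψ ≤ ω + 2`, `T ≤ 2ω`, `ψ − 4 ≤ κ·(ω − 2)` with `κ = 0.792`
(`EdgePencilDefectCone`, the tree's `α > 0.1722`), `χ` non-decreasing, `χ(δ) ≤ ψ + δ` (block cover),
`T ≤ χ(δ) + 1 − δ` (top continuity), `(5 + δ)·T ≤ 6·χ(δ)` (symmetrisation, g23) and — NEW in g24 —
`χ` CONVEX (`EdgePencilSixthConvexity.omegaSix_convexOn`). A `SixWorld` is a real model of these laws.
We exhibit worlds showing that NEITHER piece of the line «rung-and-chord»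
(`SixRungPos : ∃ δ > 0, χ(δ) ≤ ψ`; `MidTight : ψ + T ≤ 2χ(1/2)`) is decided by the record, that each
holds somewhere the other (and the leaf `T ≤ ψ`) fails — so the split is into two STRICTLY WEAKER,
mutually independent pieces — and that in EVERY world the generation-23 stub `growHalf : T ≤ χ(1/2)`
already forces the leaf (it was the crux in disguise; midpoint convexity suffices). [folklore]
-/

set_option linter.dupNamespace false

namespace Summit.MatrixMultiplication.MatrixMultiplication.Theorems.EdgePencil

/-- A model of the recorded laws of the sixth-edge ladder (g24 record, convexity included). -/
structure SixWorld where
  /-- stands for `ω` -/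
  om : ℝ
  /-- stands for `ψ = ω(2,1,2) = χ(0)` -/
  psi : ℝ
  /-- stands for `T = ω(K₄) = χ(1)` -/
  tet : ℝ
  /-- stands for the ladder `χ = omegaSix` -/
  chi : ℝ → ℝ
  chi_zero : chi 0 = psi
  chi_one : chi 1 = tet
  two_le_om : 2 ≤ om
  four_le_psi : 4 ≤ psi
  psi_le_cover : psi ≤ om + 2
  tet_le_two_mul : tet ≤ 2 * om
  kappa : psi - 4 ≤ 0.792 * (om - 2)
  mono : ∀ δ δ' : ℝ, 0 ≤ δ → δ ≤ δ' → δ' ≤ 1 → chi δ ≤ chi δ'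
  convex : ConvexOn ℝ (Set.Icc (0 : ℝ) 1) chi
  block : ∀ δ : ℝ, 0 ≤ δ → δ ≤ 1 → chi δ ≤ psi + δ
  top : ∀ δ : ℝ, 0 ≤ δ → δ ≤ 1 → tet ≤ chi δ + (1 - δ)
  symm : ∀ δ : ℝ, 0 ≤ δ → δ ≤ 1 → (5 + δ) * tet ≤ 6 * chi δ

namespace SixWorld

/-- **In every world `growHalf` is the leaf**: `T ≤ χ(1/2)` forces `T ≤ ψ` (midpoint convexity:
`χ(1/2) ≤ (ψ + T)/2`). The generation-23 stub `stub_growHalf` was therefore not weaker than the crux. -/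
theorem leaf_of_growHalf (W : SixWorld) (h : W.tet ≤ W.chi (1 / 2)) : W.tet ≤ W.psi := by
  have hc := W.convex.2 (Set.left_mem_Icc.2 (zero_le_one' ℝ)) (Set.right_mem_Icc.2 (zero_le_one' ℝ))
    (by norm_num : (0 : ℝ) ≤ 1 / 2) (by norm_num : (0 : ℝ) ≤ 1 / 2) (by norm_num)
  simp only [smul_eq_mul, mul_zero, mul_one, zero_add] at hc
  rw [W.chi_zero, W.chi_one] at hc
  linarith

/-- In every world the two pieces at the midpoint rung already give the leaf:
`χ(1/2) ≤ ψ` and `ψ + T ≤ 2χ(1/2)` force `T ≤ ψ` (the general seam, for a rung at any `δ > 0`, is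
`EdgePencilSixthConvexity.excessZero_of_sixRungPos_of_midTight`). -/
theorem leaf_of_halfRung_of_midTight (W : SixWorld) (h₁ : W.chi (1 / 2) ≤ W.psi)
    (h₂ : W.psi + W.tet ≤ 2 * W.chi (1 / 2)) : W.tet ≤ W.psi := by
  linarith

/-- **The affine world** (`ω = 2.37`, `ψ = 4.08`, `T = 4.4`, `χ(δ) = ψ + δ(T − ψ)`): the ladder IS its
chord. Here `MidTight` HOLDS, `SixRungPos` FAILS, the leaf fails. (All laws: the top and symmetrisation
laws hold with equality at `δ = 1`; `5T = 22 ≤ 6ψ = 24.48`.) -/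
noncomputable def affine : SixWorld where
  om := 2.37
  psi := 4.08
  tet := 4.4
  chi := fun δ => 4.08 + 0.32 * δ
  chi_zero := by norm_num
  chi_one := by norm_num
  two_le_om := by norm_num
  four_le_psi := by norm_num
  psi_le_cover := by norm_num
  tet_le_two_mul := by norm_num
  kappa := by norm_num
  mono := fun δ δ' _ h _ => by
    linarith
  convex := by
    refine ⟨convex_Icc 0 1, fun x _ y _ a b _ _ hab => ?_⟩
    simp only [smul_eq_mul]
    have : (4.08 : ℝ) + 0.32 * (a * x + b * y) = a * (4.08 + 0.32 * x) + b * (4.08 + 0.32 * y) := by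
      linear_combination (4.08 : ℝ) * (hab.symm)
    exact this.le
  block := fun δ h0 _ => by
    linarith
  top := fun δ _ h1 => by
    linarith
  symm := fun δ _ h1 => by
    linarith

/-- **The hinge world** (`ω = 2.37`, `ψ = 4.08`, `T = 4.3`, `χ(δ) = max(ψ, ψ + (2δ − 1)(T − ψ))`: flat
up to `δ = 1/2`, then linear of slope `2(T − ψ) = 0.44`). Here `SixRungPos` HOLDS (the rung at `1/2`),
`MidTight` FAILS, the leaf fails. (Symmetrisation law: `(5+δ)·4.3 ≤ 6·4.08` for `δ ≤ 0.69`, and on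
`[1/2, 1]` `21.5 + 4.3δ ≤ 23.16 + 2.64δ`.) -/
noncomputable def hinge : SixWorld where
  om := 2.37
  psi := 4.08
  tet := 4.3
  chi := fun δ => max 4.08 (3.86 + 0.44 * δ)
  chi_zero := by norm_num
  chi_one := by norm_num
  two_le_om := by norm_num
  four_le_psi := by norm_num
  psi_le_cover := by norm_num
  tet_le_two_mul := by norm_num
  kappa := by norm_num
  mono := fun δ δ' _ h _ => by
    exact max_le_max le_rfl (by linarith)
  convex := by
    refine ⟨convex_Icc 0 1, fun x _ y _ a b ha hb hab => ?_⟩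
    simp only [smul_eq_mul]
    have h1 := mul_le_mul_of_nonneg_left (le_max_left (4.08 : ℝ) (3.86 + 0.44 * x)) ha
    have h2 := mul_le_mul_of_nonneg_left (le_max_left (4.08 : ℝ) (3.86 + 0.44 * y)) hb
    have h3 := mul_le_mul_of_nonneg_left (le_max_right (4.08 : ℝ) (3.86 + 0.44 * x)) ha
    have h4 := mul_le_mul_of_nonneg_left (le_max_right (4.08 : ℝ) (3.86 + 0.44 * y)) hb
    refine max_le ?_ ?_
    · have : (4.08 : ℝ) = a * 4.08 + b * 4.08 := by linear_combination (4.08 : ℝ) * hab.symm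
      linarith
    · have : (3.86 : ℝ) + 0.44 * (a * x + b * y) = a * (3.86 + 0.44 * x) + b * (3.86 + 0.44 * y) := by
        linear_combination (3.86 : ℝ) * hab.symm
      linarith
  block := fun δ h0 _ => by
    exact max_le (by linarith) (by linarith)
  top := fun δ _ h1 => by
    have := le_max_right (4.08 : ℝ) (3.86 + 0.44 * δ)
    linarith
  symm := fun δ h0 h1 => by
    by_cases hδ : δ ≤ 1 / 2
    · have := le_max_left (4.08 : ℝ) (3.86 + 0.44 * δ)
      nlinarith
    · have := le_max_right (4.08 : ℝ) (3.86 + 0.44 * δ)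
      rw [not_le] at hδ
      nlinarith

/-- **`MidTight` is not decided by the record and does not give the leaf**: it holds in the affine
world (where `ω ≠ 2`, the leaf fails and `SixRungPos` fails) and fails in the hinge world. -/
theorem midTight_undecided :
    (affine.psi + affine.tet ≤ 2 * affine.chi (1 / 2) ∧ ¬ affine.tet ≤ affine.psi ∧
        ¬ ∃ δ : ℝ, 0 < δ ∧ affine.chi δ ≤ affine.psi) ∧
      ¬ (hinge.psi + hinge.tet ≤ 2 * hinge.chi (1 / 2)) := by
  refine ⟨⟨by norm_num [affine], by norm_num [affine], ?_⟩, by norm_num [hinge]⟩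
  rintro ⟨δ, hδ, h⟩
  simp only [affine] at h
  linarith

/-- **`SixRungPos` is not decided by the record and does not give the leaf**: it holds in the hinge
world (rung at `δ = 1/2`; `ω ≠ 2`, the leaf fails, `MidTight` fails) and fails in the affine world. -/
theorem sixRungPos_undecided :
    ((∃ δ : ℝ, 0 < δ ∧ hinge.chi δ ≤ hinge.psi) ∧ ¬ hinge.tet ≤ hinge.psi ∧
        ¬ (hinge.psi + hinge.tet ≤ 2 * hinge.chi (1 / 2))) ∧
      ¬ ∃ δ : ℝ, 0 < δ ∧ affine.chi δ ≤ affine.psi := by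
  refine ⟨⟨⟨1 / 2, by norm_num, by norm_num [hinge]⟩, by norm_num [hinge], by norm_num [hinge]⟩, ?_⟩
  rintro ⟨δ, hδ, h⟩
  simp only [affine] at h
  linarith

/-- The weak variants separate the same way: in the affine world `NoKink` (χ on or above its chord)
holds and `FirstOrderFree` (`∀ ε > 0 ∃ δ ∈ (0,1], χ(δ) ≤ ψ + εδ`) fails; in the hinge world
`FirstOrderFree` holds and `NoKink` fails (at `δ = 1/2`). -/
theorem weakVariants_separated :
    ((∀ δ : ℝ, 0 ≤ δ → δ ≤ 1 → (1 - δ) * affine.psi + δ * affine.tet ≤ affine.chi δ) ∧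
        ¬ ∀ ε : ℝ, 0 < ε → ∃ δ : ℝ, 0 < δ ∧ δ ≤ 1 ∧ affine.chi δ ≤ affine.psi + ε * δ) ∧
      ((∀ ε : ℝ, 0 < ε → ∃ δ : ℝ, 0 < δ ∧ δ ≤ 1 ∧ hinge.chi δ ≤ hinge.psi + ε * δ) ∧
        ¬ ∀ δ : ℝ, 0 ≤ δ → δ ≤ 1 → (1 - δ) * hinge.psi + δ * hinge.tet ≤ hinge.chi δ) := by
  refine ⟨⟨fun δ _ _ => ?_, fun h => ?_⟩, ⟨fun ε hε => ⟨1 / 2, by norm_num, by norm_num, ?_⟩, fun h => ?_⟩⟩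
  · simp only [affine]
    linarith
  · obtain ⟨δ, hδ0, _, hδ⟩ := h 0.1 (by norm_num)
    simp only [affine] at hδ
    linarith
  · simp only [hinge]
    rw [max_eq_left (by norm_num)]
    linarith
  · have h' := h (1 / 2) (by norm_num) (by norm_num)
    norm_num [hinge] at h'

end SixWorld

end Summit.MatrixMultiplication.MatrixMultiplication.Theorems.EdgePencil
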